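import Summits.ResolutionOfSingularities.ResolutionOfSingularities.Theorems.UniformComplexityCampaignW82FamilyResolutionOneFibre
import Mathlib.RingTheory.AlgebraicIndependent.Basic
import HarnessLib

/-!
# [OURS · L1 W8.2] RESOLUTION IN PENCILS, «ONE CLOSED FIBRE» FORM — campaign statement (door 2,
# `UniformComplexity` / `PrimeModelTransfer`), Theses-free module

Cell `res-hironaka` (run/shared/lean/pub/res-hironaka/), LADDER-RESOLUTION rung L (RESCUE), slot W8.2 of
plan/RESCUE-SEED.md («PRIME-FIELD / UNIVERSALITY TRANSFER instead of descent: resolve over 𝔽_p or 𝔽̄_p and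
transfer FAMILIES»). SECOND DOOR: route `UniformComplexity`, item `PrimeModelTransfer`
(stmt-ResolutionOfSingularities-8933). Self-typed by the slot's prover res-L1-s82-pv-2 (gen 6) under the
rung-B precedent, as a sequel to `Theorems/UniformComplexityCampaignW82FamilyResolutionOneFibre.lean`
(p540376/p543776: `CampaignW82.FamilyResolutionOneFibre k`, kernel-checked EQUIVALENT to the crux slice by
`CampaignW82.primeModelTransfer_iff_familyResolutionOneFibre`, p545198). NOTHING is proved about
resolution of singularities here and nothing is asserted: one `def` and one pure-logic anchor.

WHY THIS FILE. `FamilyResolutionOneFibre k` quantifies over proper families over ALL finitely generated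
`k`-domains `A`. The crux kernel's lead c3 (tree file `Summits/…/Cruxes/PrimeFieldToPerfect/KERNEL-c3.md`
§1, target (5.1)) phrased the residual for ONE-PARAMETER families: «for every projective flat
`𝒴 → 𝔸¹_M`-open … some [base change] admits, over a dense open of the base, a modification with ONE smooth
closed fibre». This module types the PENCIL restriction: the same one-closed-fibre datum, asked only for
bases `A` of transcendence degree `≤ 1` over `k` (Mathlib `Algebra.trdeg k A ≤ 1`: `Spec A` is a point or
an affine `k`-curve). The prover's theorem (gen 6, Theses-importing links leaf): for a prime `p`,
`PrimeModelTransferAt p ↔ ∀ M` algebraically closed of characteristic `p`, (resolution over `M`) `→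
PencilResolutionOneFibre M` — through the one-transcendental climb `CampaignW82.ClimbAlgClosed p`
(p481773/p489826: `Res(M) ⇒ Res(K)` for algebraically closed `K ⊇ M` of transcendence degree `≤ 1`): a
`K`-variety descends to a proper family over a finitely generated `M`-subalgebra `R ⊆ K`, and
`trdeg_M R ≤ trdeg_M K ≤ 1` makes it a pencil. (Bases of transcendence degree EXACTLY one over arbitrary
affine curves are needed, not only opens of `𝔸¹`: the descended field of definition is a finite extension
of `M(t)`, the function field of a curve.)

BUILD RULE (cell, director-resolution 2026-08-26T18:53:29Z (B)): OURS vocabulary file, THESES-FREE BY BIRTH —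
imports only the Theses-free gen-6 vocabulary module, Mathlib and `HarnessLib`.

HONEST FRAMING. The `def` below is OURS — a campaign statement that REPLACES THE ROLE of a printed item of
H. Hironaka's manuscript *Resolution of singularities in positive characteristics* (2017-03-23, [Hironaka2017],
lit key `paper:url-3343fd9e678b`) — namely §17 ¶2, p.89 l.59–62: «In this work the base field K is always
assumed to be a finite field or Z/pZ because our resolution is for all dimension. When the K has transcendence
degree d we can reformulate the resolution problem to the case of dimension d + dim Z.» (typed AS PRINTED, not
asserted, as `S17Methodology.U89_2` / `U89_3`). The printed sentence reformulates a variety over a field of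
transcendence degree `d` as a family; the statement below is the `d = 1` step of that reformulation in the
one-closed-fibre form — what must be done to a PENCIL of `M`-varieties (one resolved closed fibre, flatly,
after an algebraic base change of the curve) for the transcendence degree to climb by one between
algebraically closed fields. Hironaka's statements are CANDIDATES under adjudication (D-0012/D-0089);
nothing here is attributed to the author and no verdict on the manuscript is implied. AI typing, weaker than
expert review.

VACUITY SELF-CHECK (for `k` algebraically closed of characteristic `p`): not trivially true — at `A = k`
(`trdeg = 0`) the datum is a resolution of the given integral proper `k`-scheme (open in dimension `≥ 4`);
not trivially false — implied by `FamilyResolutionOneFibre k` (anchor below), hence by `AlgClosedRes p`.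

## References (vocabulary and locators only; nothing cited as a premise)
* H. Hironaka, ms. 2017-03-23, §17 ¶2 p.89 l.59–62 — under adjudication, quoted for the role replaced, not
  asserted. [Hironaka2017]
* A. Grothendieck, J. Dieudonné, EGA IV₃ (1966) Thm. 12.2.4 (iii) — one smooth fibre of a flat proper family
  (docstring vocabulary). [EGAIV3]
* Tree: `Summits/…/Cruxes/PrimeFieldToPerfect/KERNEL-c3.md` §1, (5.1) — cell file, OURS.
-/

noncomputable section

set_option linter.dupNamespace false -- mandated namespace of this single-conjunct summit

open _root_.CategoryTheory _root_.CategoryTheory.Limits _root_.AlgebraicGeometry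
open Literature.AlgebraicGeometry.Resolution

namespace Summit.ResolutionOfSingularities.ResolutionOfSingularities.Theorems.CampaignW82

/-- [OURS · L1 W8.2 door 2] replaces the role of §17 ¶2, p.89 l.59–62 (the variety over a field of
transcendence degree `d` as a family — here `d = 1`, a PENCIL; `S17Methodology.U89_3`) in the
one-closed-fibre form; NOT a statement of the manuscript. **RESOLUTION IN PENCILS, ONE-CLOSED-FIBRE FORM,
over `k`.** For every finitely generated `k`-algebra `A` that is a domain of TRANSCENDENCE DEGREE `≤ 1` over
`k` (`Algebra.trdeg k A ≤ 1`: `Spec A` is a point or an affine `k`-curve) and every PROPER `f : 𝒳 → Spec A`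
whose geometric generic fibre `𝒳 ×_{Spec A} Spec (Frac A)^{alg}` is integral, there exist a domain `A'` with
an INJECTIVE, FINITE-TYPE, ALGEBRAIC `A`-algebra structure (a curve generically finite over `Spec A`, after
shrinking), a scheme `𝒴`, a morphism `G : 𝒴 → 𝒳' := 𝒳 ×_{Spec A} Spec A'`, an open `W ⊆ 𝒳'` and a CLOSED
point `s` of `Spec A'` such that: `G` is PROPER; `G` restricts to an ISOMORPHISM over `W`; `W` meets the fibre
of `𝒳'` over `s`; `q : 𝒴 → Spec A'` is FLAT AT THE POINTS OVER `s`; and the fibre `q⁻¹(s) → Spec κ(s)` is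
SMOOTH. VERBATIM the clause of `FamilyResolutionOneFibre k` (p540376), restricted to bases of transcendence
degree `≤ 1` (anchor `pencilResolutionOneFibre_of_familyResolutionOneFibre`). Prover's theorem (gen 6, links
leaf): `PrimeModelTransferAt p ↔ ∀ M` algebraically closed of characteristic `p`, Res(`M`) `→
PencilResolutionOneFibre M` (via `ClimbAlgClosed p`, p489826, and the E7 theorem of p542421 run over the
finitely generated `M`-subalgebras of an algebraically closed `K` with `trdeg_M K ≤ 1`). Barrier
bookkeeping: as for `FamilyResolutionOneFibre` (the inseparability is in «`A → A'` algebraic» and in FLAT).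
Vacuity (`k` algebraically closed of characteristic `p`): not trivially true (`A = k`: resolution of the
given integral proper `k`-scheme); not trivially false (⇐ `FamilyResolutionOneFibre k` ⇐ `AlgClosedRes p`).
Composite characteristic: not intended. [folklore] -/
def PencilResolutionOneFibre (k : Type) [Field k] : Prop :=
  ∀ (A : Type) [CommRing A] [IsDomain A] [Algebra k A], Algebra.FiniteType k A → Algebra.trdeg k A ≤ 1 →
    ∀ (𝒳 : Scheme.{0}) (f : 𝒳 ⟶ Spec (.of A)), IsProper f →
      IsIntegral (pullback f (Spec.map (CommRingCat.ofHom
          (algebraMap A (AlgebraicClosure (FractionRing A)))))) →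
      ∃ (A' : Type) (_ : CommRing A') (_ : IsDomain A') (_ : Algebra A A'),
        Function.Injective (algebraMap A A') ∧ Algebra.FiniteType A A' ∧ Algebra.IsAlgebraic A A' ∧
        ∃ (𝒴 : Scheme.{0})
          (G : 𝒴 ⟶ pullback f (Spec.map (CommRingCat.ofHom (algebraMap A A'))))
          (W : (pullback f (Spec.map (CommRingCat.ofHom (algebraMap A A')))).Opens)
          (s : ↥(Spec (.of A'))),
          IsClosed ({s} : Set ↥(Spec (.of A'))) ∧
          IsProper G ∧
          IsIso (G ∣_ W) ∧
          (∃ x : ↥(pullback f (Spec.map (CommRingCat.ofHom (algebraMap A A')))),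
            x ∈ W ∧ (pullback.snd f (Spec.map (CommRingCat.ofHom (algebraMap A A')))) x = s) ∧
          (∀ y : ↥𝒴, (G ≫ pullback.snd f (Spec.map (CommRingCat.ofHom (algebraMap A A')))) y = s →
            ((G ≫ pullback.snd f (Spec.map (CommRingCat.ofHom (algebraMap A A')))).stalkMap y).hom.Flat) ∧
          Smooth ((G ≫ pullback.snd f (Spec.map (CommRingCat.ofHom (algebraMap A A')))).fiberToSpecResidueField s)

/-- Anchor (pure logic): the pencil form is the restriction of `FamilyResolutionOneFibre k` to bases of
transcendence degree `≤ 1`. [folklore] -/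
theorem pencilResolutionOneFibre_of_familyResolutionOneFibre {k : Type} [Field k]
    (h : FamilyResolutionOneFibre k) : PencilResolutionOneFibre k :=
  fun A _ _ _ hA _ 𝒳 f hf hint => h A hA 𝒳 f hf hint

end Summit.ResolutionOfSingularities.ResolutionOfSingularities.Theorems.CampaignW82

end
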